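import Mathlib
import Literature.GroupTheory.DiffuseGroups.Bowditch2000

/-!
# The Janzen–Wise (4,4)-lattice `Γ_JW` is not diffuse

`Γ_JW = ⟨a, b, x, y ∣ axay, ax⁻¹by⁻¹, ay⁻¹b⁻¹x⁻¹, bxb⁻¹y⁻¹⟩` is one of the two irreducible torsion-free
BMW groups of degree `(4,4)`; it is not residually finite ([cite: BondarenkoKivva2017, Theorem 3]; Caprace–Wesolek, see
[cite: Caprace2017, Example 4.3]). We certify a
24-element ravel inside the ball of radius 3 of its Cayley graph, so `Γ_JW` is not diffuse in Bowditch's sense and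
therefore not left-orderable. (The ball of radius 2 is ravel-free; machine computation, not certified here.)

References: [cite: Caprace2017, Example 4.3] for the presentation (the group is due to
Janzen–Wise [cite: JanzenWise2009]); [cite: Bowditch2000, §1–2] and [cite: KionkeRaimbault2016, §2.1] for diffuse groups,
extremal points and ravels (`Literature.GroupTheory.DiffuseGroups.Bowditch2000`).

The certificate (the 24 words, the witness maps `J`, `K` and the separating finite quotient) was found
by machine search (extremal-point peeling of the ball of radius 3 leaves a 207-element ravel (the ball of radius 2 is ravel-free); greedy shrinking over 40 random orders produced ravels of 24–65 elements, and this smallest one is also the only one of them whose witness pairs are all separated by a single finite quotient (degree 5, image of order 6); AI-run computation of the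
`pub-kaplansky` unit, 2026-08-19, cross-checked by two independent implementations of the word problem) and is checked here by the kernel: the word identities by
rewriting to the `VH` normal form with the sixteen corner relations of the square complex, the
inequalities through an explicit homomorphism to `Equiv.Perm (Fin 5)`.
-/

namespace Literature.GroupTheory.BMWGroups.Caprace2017

open Literature.GroupTheory.DiffuseGroups

namespace GammaJW

/-- Generator symbols: `a`, `b` (vertical) and `x`, `y` (horizontal). [cite: Caprace2017, Example 4.3] -/
inductive L | a | b | x | y
  deriving DecidableEq, Repr

/-- The four relators (squares of the BMW complex). [cite: Caprace2017, Example 4.3] -/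
def r (k : Fin 4) : FreeGroup L :=
  ![FreeGroup.of L.a * FreeGroup.of L.x * FreeGroup.of L.a * FreeGroup.of L.y,
    FreeGroup.of L.a * (FreeGroup.of L.x)⁻¹ * FreeGroup.of L.b * (FreeGroup.of L.y)⁻¹,
    FreeGroup.of L.a * (FreeGroup.of L.y)⁻¹ * (FreeGroup.of L.b)⁻¹ * (FreeGroup.of L.x)⁻¹,
    FreeGroup.of L.b * FreeGroup.of L.x * (FreeGroup.of L.b)⁻¹ * (FreeGroup.of L.y)⁻¹] k

/-- The relator set. [cite: Caprace2017, Example 4.3] -/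
def rels : Set (FreeGroup L) := Set.range r

end GammaJW

/-- The Janzen–Wise lattice `Γ_JW = ⟨a, b, x, y ∣ axay, ax⁻¹by⁻¹, ay⁻¹b⁻¹x⁻¹, bxb⁻¹y⁻¹⟩`, an irreducible torsion-free BMW group of degree (4,4), not residually finite. [cite: Caprace2017, Example 4.3] -/
abbrev GammaJWGroup : Type := PresentedGroup GammaJW.rels

namespace GammaJW

/-- The generator `a` (vertical). [cite: Caprace2017, Example 4.3] -/
def a : GammaJWGroup := PresentedGroup.of L.a
/-- The generator `b` (vertical). [cite: Caprace2017, Example 4.3] -/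
def b : GammaJWGroup := PresentedGroup.of L.b
/-- The generator `x` (horizontal). [cite: Caprace2017, Example 4.3] -/
def x : GammaJWGroup := PresentedGroup.of L.x
/-- The generator `y` (horizontal). [cite: Caprace2017, Example 4.3] -/
def y : GammaJWGroup := PresentedGroup.of L.y

/-- The relators hold in the presented group. [cite: Caprace2017, Example 4.3] -/
theorem r_eq_one (k : Fin 4) : (PresentedGroup.mk rels (r k) : GammaJWGroup) = 1 :=
  (QuotientGroup.eq_one_iff _).2 (Subgroup.subset_normalClosure ⟨k, rfl⟩)

/-- Relator 1: `a * x * a * y = 1`. [cite: Caprace2017, Example 4.3] -/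
theorem rel1 : (a * x * a * y : GammaJWGroup) = 1 := by
  have h := r_eq_one 0
  simpa [r, a, b, x, y, PresentedGroup.of, mul_assoc] using h

/-- Relator 2: `a * x⁻¹ * b * y⁻¹ = 1`. [cite: Caprace2017, Example 4.3] -/
theorem rel2 : (a * x⁻¹ * b * y⁻¹ : GammaJWGroup) = 1 := by
  have h := r_eq_one 1
  simpa [r, a, b, x, y, PresentedGroup.of, mul_assoc] using h

/-- Relator 3: `a * y⁻¹ * b⁻¹ * x⁻¹ = 1`. [cite: Caprace2017, Example 4.3] -/
theorem rel3 : (a * y⁻¹ * b⁻¹ * x⁻¹ : GammaJWGroup) = 1 := by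
  have h := r_eq_one 2
  simpa [r, a, b, x, y, PresentedGroup.of, mul_assoc] using h

/-- Relator 4: `b * x * b⁻¹ * y⁻¹ = 1`. [cite: Caprace2017, Example 4.3] -/
theorem rel4 : (b * x * b⁻¹ * y⁻¹ : GammaJWGroup) = 1 := by
  have h := r_eq_one 3
  simpa [r, a, b, x, y, PresentedGroup.of, mul_assoc] using h

/-! ## The sixteen corner relations `h v = v' h'` (one per corner of the link `K_{4,4}`) -/

/-- Corner relation `y⁻¹ * b⁻¹ = a⁻¹ * x` (from relator 3). [cite: Caprace2017, Example 4.3] -/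
theorem c_yi_bi : (y⁻¹ * b⁻¹ : GammaJWGroup) = a⁻¹ * x := by
  calc (y⁻¹ * b⁻¹ : GammaJWGroup) = (a⁻¹ * (a * y⁻¹ * b⁻¹ * x⁻¹) * a) * (a⁻¹ * x) := by group
    _ = a⁻¹ * x := by rw [rel3]; group

/-- Corner relation `c_yi_bi` in associated form (for rewriting inside longer words). [cite: Caprace2017, Example 4.3] -/
theorem c_yi_bi' (w : GammaJWGroup) : y⁻¹ * (b⁻¹ * w) = a⁻¹ * (x * w) := by
  rw [← mul_assoc, c_yi_bi, mul_assoc]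

/-- Corner relation `y⁻¹ * a⁻¹ = a * x` (from relator 1). [cite: Caprace2017, Example 4.3] -/
theorem c_yi_ai : (y⁻¹ * a⁻¹ : GammaJWGroup) = a * x := by
  calc (y⁻¹ * a⁻¹ : GammaJWGroup) = ((a * x * a * y)⁻¹) * (a * x) := by group
    _ = a * x := by rw [rel1]; group

/-- Corner relation `c_yi_ai` in associated form (for rewriting inside longer words). [cite: Caprace2017, Example 4.3] -/
theorem c_yi_ai' (w : GammaJWGroup) : y⁻¹ * (a⁻¹ * w) = a * (x * w) := by
  rw [← mul_assoc, c_yi_ai, mul_assoc]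

/-- Corner relation `y⁻¹ * a = b⁻¹ * x` (from relator 2). [cite: Caprace2017, Example 4.3] -/
theorem c_yi_a : (y⁻¹ * a : GammaJWGroup) = b⁻¹ * x := by
  calc (y⁻¹ * a : GammaJWGroup) = (b⁻¹ * x * a⁻¹ * (a * x⁻¹ * b * y⁻¹) * a * x⁻¹ * b) * (b⁻¹ * x) := by group
    _ = b⁻¹ * x := by rw [rel2]; group

/-- Corner relation `c_yi_a` in associated form (for rewriting inside longer words). [cite: Caprace2017, Example 4.3] -/
theorem c_yi_a' (w : GammaJWGroup) : y⁻¹ * (a * w) = b⁻¹ * (x * w) := by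
  rw [← mul_assoc, c_yi_a, mul_assoc]

/-- Corner relation `y⁻¹ * b = b * x⁻¹` (from relator 4). [cite: Caprace2017, Example 4.3] -/
theorem c_yi_b : (y⁻¹ * b : GammaJWGroup) = b * x⁻¹ := by
  calc (y⁻¹ * b : GammaJWGroup) = (b * x⁻¹ * b⁻¹ * (b * x * b⁻¹ * y⁻¹) * b * x * b⁻¹) * (b * x⁻¹) := by group
    _ = b * x⁻¹ := by rw [rel4]; group

/-- Corner relation `c_yi_b` in associated form (for rewriting inside longer words). [cite: Caprace2017, Example 4.3] -/
theorem c_yi_b' (w : GammaJWGroup) : y⁻¹ * (b * w) = b * (x⁻¹ * w) := by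
  rw [← mul_assoc, c_yi_b, mul_assoc]

/-- Corner relation `x⁻¹ * b⁻¹ = b⁻¹ * y⁻¹` (from relator 4). [cite: Caprace2017, Example 4.3] -/
theorem c_xi_bi : (x⁻¹ * b⁻¹ : GammaJWGroup) = b⁻¹ * y⁻¹ := by
  calc (x⁻¹ * b⁻¹ : GammaJWGroup) = (b⁻¹ * y⁻¹ * (b * x * b⁻¹ * y⁻¹)⁻¹ * y * b) * (b⁻¹ * y⁻¹) := by group
    _ = b⁻¹ * y⁻¹ := by rw [rel4]; group

/-- Corner relation `c_xi_bi` in associated form (for rewriting inside longer words). [cite: Caprace2017, Example 4.3] -/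
theorem c_xi_bi' (w : GammaJWGroup) : x⁻¹ * (b⁻¹ * w) = b⁻¹ * (y⁻¹ * w) := by
  rw [← mul_assoc, c_xi_bi, mul_assoc]

/-- Corner relation `x⁻¹ * a⁻¹ = a * y` (from relator 1). [cite: Caprace2017, Example 4.3] -/
theorem c_xi_ai : (x⁻¹ * a⁻¹ : GammaJWGroup) = a * y := by
  calc (x⁻¹ * a⁻¹ : GammaJWGroup) = (a * y * (a * x * a * y)⁻¹ * y⁻¹ * a⁻¹) * (a * y) := by group
    _ = a * y := by rw [rel1]; group

/-- Corner relation `c_xi_ai` in associated form (for rewriting inside longer words). [cite: Caprace2017, Example 4.3] -/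
theorem c_xi_ai' (w : GammaJWGroup) : x⁻¹ * (a⁻¹ * w) = a * (y * w) := by
  rw [← mul_assoc, c_xi_ai, mul_assoc]

/-- Corner relation `x⁻¹ * a = b * y` (from relator 3). [cite: Caprace2017, Example 4.3] -/
theorem c_xi_a : (x⁻¹ * a : GammaJWGroup) = b * y := by
  calc (x⁻¹ * a : GammaJWGroup) = (b * y * a⁻¹ * (a * y⁻¹ * b⁻¹ * x⁻¹) * a * y⁻¹ * b⁻¹) * (b * y) := by group
    _ = b * y := by rw [rel3]; group

/-- Corner relation `c_xi_a` in associated form (for rewriting inside longer words). [cite: Caprace2017, Example 4.3] -/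
theorem c_xi_a' (w : GammaJWGroup) : x⁻¹ * (a * w) = b * (y * w) := by
  rw [← mul_assoc, c_xi_a, mul_assoc]

/-- Corner relation `x⁻¹ * b = a⁻¹ * y` (from relator 2). [cite: Caprace2017, Example 4.3] -/
theorem c_xi_b : (x⁻¹ * b : GammaJWGroup) = a⁻¹ * y := by
  calc (x⁻¹ * b : GammaJWGroup) = (a⁻¹ * (a * x⁻¹ * b * y⁻¹) * a) * (a⁻¹ * y) := by group
    _ = a⁻¹ * y := by rw [rel2]; group

/-- Corner relation `c_xi_b` in associated form (for rewriting inside longer words). [cite: Caprace2017, Example 4.3] -/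
theorem c_xi_b' (w : GammaJWGroup) : x⁻¹ * (b * w) = a⁻¹ * (y * w) := by
  rw [← mul_assoc, c_xi_b, mul_assoc]

/-- Corner relation `x * b⁻¹ = b⁻¹ * y` (from relator 4). [cite: Caprace2017, Example 4.3] -/
theorem c_x_bi : (x * b⁻¹ : GammaJWGroup) = b⁻¹ * y := by
  calc (x * b⁻¹ : GammaJWGroup) = (b⁻¹ * (b * x * b⁻¹ * y⁻¹) * b) * (b⁻¹ * y) := by group
    _ = b⁻¹ * y := by rw [rel4]; group

/-- Corner relation `c_x_bi` in associated form (for rewriting inside longer words). [cite: Caprace2017, Example 4.3] -/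
theorem c_x_bi' (w : GammaJWGroup) : x * (b⁻¹ * w) = b⁻¹ * (y * w) := by
  rw [← mul_assoc, c_x_bi, mul_assoc]

/-- Corner relation `x * a⁻¹ = b * y⁻¹` (from relator 2). [cite: Caprace2017, Example 4.3] -/
theorem c_x_ai : (x * a⁻¹ : GammaJWGroup) = b * y⁻¹ := by
  calc (x * a⁻¹ : GammaJWGroup) = (b * y⁻¹ * (a * x⁻¹ * b * y⁻¹)⁻¹ * y * b⁻¹) * (b * y⁻¹) := by group
    _ = b * y⁻¹ := by rw [rel2]; group

/-- Corner relation `c_x_ai` in associated form (for rewriting inside longer words). [cite: Caprace2017, Example 4.3] -/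
theorem c_x_ai' (w : GammaJWGroup) : x * (a⁻¹ * w) = b * (y⁻¹ * w) := by
  rw [← mul_assoc, c_x_ai, mul_assoc]

/-- Corner relation `x * a = a⁻¹ * y⁻¹` (from relator 1). [cite: Caprace2017, Example 4.3] -/
theorem c_x_a : (x * a : GammaJWGroup) = a⁻¹ * y⁻¹ := by
  calc (x * a : GammaJWGroup) = (a⁻¹ * (a * x * a * y) * a) * (a⁻¹ * y⁻¹) := by group
    _ = a⁻¹ * y⁻¹ := by rw [rel1]; group

/-- Corner relation `c_x_a` in associated form (for rewriting inside longer words). [cite: Caprace2017, Example 4.3] -/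
theorem c_x_a' (w : GammaJWGroup) : x * (a * w) = a⁻¹ * (y⁻¹ * w) := by
  rw [← mul_assoc, c_x_a, mul_assoc]

/-- Corner relation `x * b = a * y⁻¹` (from relator 3). [cite: Caprace2017, Example 4.3] -/
theorem c_x_b : (x * b : GammaJWGroup) = a * y⁻¹ := by
  calc (x * b : GammaJWGroup) = ((a * y⁻¹ * b⁻¹ * x⁻¹)⁻¹) * (a * y⁻¹) := by group
    _ = a * y⁻¹ := by rw [rel3]; group

/-- Corner relation `c_x_b` in associated form (for rewriting inside longer words). [cite: Caprace2017, Example 4.3] -/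
theorem c_x_b' (w : GammaJWGroup) : x * (b * w) = a * (y⁻¹ * w) := by
  rw [← mul_assoc, c_x_b, mul_assoc]

/-- Corner relation `y * b⁻¹ = a * x⁻¹` (from relator 2). [cite: Caprace2017, Example 4.3] -/
theorem c_y_bi : (y * b⁻¹ : GammaJWGroup) = a * x⁻¹ := by
  calc (y * b⁻¹ : GammaJWGroup) = ((a * x⁻¹ * b * y⁻¹)⁻¹) * (a * x⁻¹) := by group
    _ = a * x⁻¹ := by rw [rel2]; group

/-- Corner relation `c_y_bi` in associated form (for rewriting inside longer words). [cite: Caprace2017, Example 4.3] -/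
theorem c_y_bi' (w : GammaJWGroup) : y * (b⁻¹ * w) = a * (x⁻¹ * w) := by
  rw [← mul_assoc, c_y_bi, mul_assoc]

/-- Corner relation `y * a⁻¹ = b⁻¹ * x⁻¹` (from relator 3). [cite: Caprace2017, Example 4.3] -/
theorem c_y_ai : (y * a⁻¹ : GammaJWGroup) = b⁻¹ * x⁻¹ := by
  calc (y * a⁻¹ : GammaJWGroup) = (b⁻¹ * x⁻¹ * (a * y⁻¹ * b⁻¹ * x⁻¹)⁻¹ * x * b) * (b⁻¹ * x⁻¹) := by group
    _ = b⁻¹ * x⁻¹ := by rw [rel3]; group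

/-- Corner relation `c_y_ai` in associated form (for rewriting inside longer words). [cite: Caprace2017, Example 4.3] -/
theorem c_y_ai' (w : GammaJWGroup) : y * (a⁻¹ * w) = b⁻¹ * (x⁻¹ * w) := by
  rw [← mul_assoc, c_y_ai, mul_assoc]

/-- Corner relation `y * a = a⁻¹ * x⁻¹` (from relator 1). [cite: Caprace2017, Example 4.3] -/
theorem c_y_a : (y * a : GammaJWGroup) = a⁻¹ * x⁻¹ := by
  calc (y * a : GammaJWGroup) = (a⁻¹ * x⁻¹ * a⁻¹ * (a * x * a * y) * a * x * a) * (a⁻¹ * x⁻¹) := by group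
    _ = a⁻¹ * x⁻¹ := by rw [rel1]; group

/-- Corner relation `c_y_a` in associated form (for rewriting inside longer words). [cite: Caprace2017, Example 4.3] -/
theorem c_y_a' (w : GammaJWGroup) : y * (a * w) = a⁻¹ * (x⁻¹ * w) := by
  rw [← mul_assoc, c_y_a, mul_assoc]

/-- Corner relation `y * b = b * x` (from relator 4). [cite: Caprace2017, Example 4.3] -/
theorem c_y_b : (y * b : GammaJWGroup) = b * x := by
  calc (y * b : GammaJWGroup) = ((b * x * b⁻¹ * y⁻¹)⁻¹) * (b * x) := by group
    _ = b * x := by rw [rel4]; group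

/-- Corner relation `c_y_b` in associated form (for rewriting inside longer words). [cite: Caprace2017, Example 4.3] -/
theorem c_y_b' (w : GammaJWGroup) : y * (b * w) = b * (x * w) := by
  rw [← mul_assoc, c_y_b, mul_assoc]

/-! ## The ravel: 24 elements of the ball of radius 3 (by word length: {'0': 0, '1': 4, '2': 11, '3': 9}) -/

/-- The 24 elements of the ravel, as words in the generators. [cite: KionkeRaimbault2016, §2.1] -/
def f : Fin 24 → GammaJWGroup :=
  ![y⁻¹,
    x,
    y,
    a,
    y⁻¹ * y⁻¹,
    x⁻¹ * x⁻¹,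
    x * x,
    y * y,
    b⁻¹ * b⁻¹,
    a⁻¹ * a⁻¹,
    a⁻¹ * b,
    a * a,
    a * b,
    b * a⁻¹,
    b * a,
    a⁻¹ * x * y,
    a⁻¹ * b⁻¹ * x⁻¹,
    a⁻¹ * a⁻¹ * y,
    a * y⁻¹ * x,
    a * x⁻¹ * y⁻¹,
    a * a * y⁻¹,
    a * a * x,
    a * b * y,
    b * a⁻¹ * x⁻¹]

/-- First witness map: `f (J i) · (f i)⁻¹ · f (K i) = f i`. [cite: KionkeRaimbault2016, §2.1] -/
def J : Fin 24 → Fin 24 := ![8, 8, 8, 1, 8, 8, 8, 8, 15, 1, 0, 0, 2, 16, 1, 9, 5, 7, 6, 11, 4, 3, 7, 5]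

/-- Second witness map. [cite: KionkeRaimbault2016, §2.1] -/
def K : Fin 24 → Fin 24 := ![13, 12, 14, 22, 14, 12, 10, 13, 19, 16, 17, 22, 20, 21, 23, 10, 9, 10, 12, 12, 12, 18, 11, 14]

/-- The witness identities `f (J i) · (f i)⁻¹ · f (K i) = f i`, by rewriting both sides to `VH` normal form
with the corner relations. [cite: KionkeRaimbault2016, §2.1] -/
theorem f_rel : ∀ i : Fin 24, f (J i) * (f i)⁻¹ * f (K i) = f i := by
  intro i
  fin_cases i
  all_goals
    simp only [f, J, K, Fin.isValue, Matrix.cons_val_zero,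
      Matrix.cons_val, Fin.mk_zero, Fin.mk_one, Fin.reduceFinMk]
  all_goals
    simp only [mul_assoc, mul_inv_rev, inv_inv, mul_one, mul_inv_cancel_left, inv_mul_cancel_left,
      mul_inv_cancel, inv_mul_cancel, c_yi_bi', c_yi_ai', c_yi_a', c_yi_b', c_xi_bi', c_xi_ai', c_xi_a', c_xi_b', c_x_bi', c_x_ai', c_x_a', c_x_b', c_y_bi', c_y_ai', c_y_a', c_y_b', c_yi_bi, c_yi_a, c_yi_b, c_xi_ai, c_xi_a, c_xi_b, c_x_ai, c_x_a, c_x_b, c_y_bi, c_y_ai, c_y_a, c_y_b]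

/-- Image of `a` in the separating finite quotient `Equiv.Perm (Fin 5)` (certificate data). [folklore] -/
def pa : Equiv.Perm (Fin 5) := ⟨![1, 0, 3, 4, 2], ![1, 0, 4, 2, 3], by decide, by decide⟩

/-- Image of `b` in the separating finite quotient `Equiv.Perm (Fin 5)` (certificate data). [folklore] -/
def pb : Equiv.Perm (Fin 5) := ⟨![1, 0, 2, 3, 4], ![1, 0, 2, 3, 4], by decide, by decide⟩

/-- Image of `x` in the separating finite quotient `Equiv.Perm (Fin 5)` (certificate data). [folklore] -/
def px : Equiv.Perm (Fin 5) := ⟨![0, 1, 4, 2, 3], ![0, 1, 3, 4, 2], by decide, by decide⟩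

/-- Image of `y` in the separating finite quotient `Equiv.Perm (Fin 5)` (certificate data). [folklore] -/
def py : Equiv.Perm (Fin 5) := ⟨![0, 1, 4, 2, 3], ![0, 1, 3, 4, 2], by decide, by decide⟩

/-- Letter images (certificate data). [folklore] -/
def pl : L → Equiv.Perm (Fin 5)
  | .a => pa | .b => pb | .x => px | .y => py

/-- The letter images satisfy the four relators. [cite: Caprace2017, Example 4.3] -/
theorem lift_r (k : Fin 4) : FreeGroup.lift GammaJW.pl (GammaJW.r k) = 1 := by
  fin_cases k <;> simp [r, pl] <;> decide

/-- The separating homomorphism to `Equiv.Perm (Fin 5)` (von Dyck). [folklore] -/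
def φ : GammaJWGroup →* Equiv.Perm (Fin 5) :=
  PresentedGroup.toGroup (f := pl) (by rintro _ ⟨k, rfl⟩; exact lift_r k)

/-- Value of `φ` on the generator `a`. [folklore] -/
@[simp] theorem φ_a : φ a = pa := PresentedGroup.toGroup.of _
/-- Value of `φ` on the generator `b`. [folklore] -/
@[simp] theorem φ_b : φ b = pb := PresentedGroup.toGroup.of _
/-- Value of `φ` on the generator `x`. [folklore] -/
@[simp] theorem φ_x : φ x = px := PresentedGroup.toGroup.of _
/-- Value of `φ` on the generator `y`. [folklore] -/
@[simp] theorem φ_y : φ y = py := PresentedGroup.toGroup.of _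

/-- The images `φ (f i)` (certificate data). [folklore] -/
def fimg : Fin 24 → Equiv.Perm (Fin 5) :=
  ![⟨![0, 1, 3, 4, 2], ![0, 1, 4, 2, 3], by decide, by decide⟩,
    ⟨![0, 1, 4, 2, 3], ![0, 1, 3, 4, 2], by decide, by decide⟩,
    ⟨![0, 1, 4, 2, 3], ![0, 1, 3, 4, 2], by decide, by decide⟩,
    ⟨![1, 0, 3, 4, 2], ![1, 0, 4, 2, 3], by decide, by decide⟩,
    ⟨![0, 1, 4, 2, 3], ![0, 1, 3, 4, 2], by decide, by decide⟩,
    ⟨![0, 1, 4, 2, 3], ![0, 1, 3, 4, 2], by decide, by decide⟩,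
    ⟨![0, 1, 3, 4, 2], ![0, 1, 4, 2, 3], by decide, by decide⟩,
    ⟨![0, 1, 3, 4, 2], ![0, 1, 4, 2, 3], by decide, by decide⟩,
    ⟨![0, 1, 2, 3, 4], ![0, 1, 2, 3, 4], by decide, by decide⟩,
    ⟨![0, 1, 3, 4, 2], ![0, 1, 4, 2, 3], by decide, by decide⟩,
    ⟨![0, 1, 4, 2, 3], ![0, 1, 3, 4, 2], by decide, by decide⟩,
    ⟨![0, 1, 4, 2, 3], ![0, 1, 3, 4, 2], by decide, by decide⟩,
    ⟨![0, 1, 3, 4, 2], ![0, 1, 4, 2, 3], by decide, by decide⟩,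
    ⟨![0, 1, 4, 2, 3], ![0, 1, 3, 4, 2], by decide, by decide⟩,
    ⟨![0, 1, 3, 4, 2], ![0, 1, 4, 2, 3], by decide, by decide⟩,
    ⟨![1, 0, 2, 3, 4], ![1, 0, 2, 3, 4], by decide, by decide⟩,
    ⟨![0, 1, 2, 3, 4], ![0, 1, 2, 3, 4], by decide, by decide⟩,
    ⟨![0, 1, 2, 3, 4], ![0, 1, 2, 3, 4], by decide, by decide⟩,
    ⟨![1, 0, 3, 4, 2], ![1, 0, 4, 2, 3], by decide, by decide⟩,
    ⟨![1, 0, 2, 3, 4], ![1, 0, 2, 3, 4], by decide, by decide⟩,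
    ⟨![0, 1, 2, 3, 4], ![0, 1, 2, 3, 4], by decide, by decide⟩,
    ⟨![0, 1, 3, 4, 2], ![0, 1, 4, 2, 3], by decide, by decide⟩,
    ⟨![0, 1, 2, 3, 4], ![0, 1, 2, 3, 4], by decide, by decide⟩,
    ⟨![0, 1, 2, 3, 4], ![0, 1, 2, 3, 4], by decide, by decide⟩]

/-- `φ ∘ f = fimg`. [folklore] -/
theorem φ_f : ∀ i : Fin 24, φ (f i) = fimg i := by
  intro i
  fin_cases i
  all_goals
    simp only [f, fimg, Fin.isValue, Matrix.cons_val_zero, Matrix.cons_val,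
      Fin.mk_zero, Fin.mk_one, Fin.reduceFinMk, map_mul, map_inv, φ_a, φ_b, φ_x, φ_y]
  all_goals decide

/-- The finite quotient separates `f (J i)` from `f i` for every `i`. [folklore] -/
theorem fimg_ne : ∀ i : Fin 24, fimg (J i) ≠ fimg i := by decide

/-- The inequalities `f (J i) ≠ f i`, through the finite quotient. [cite: KionkeRaimbault2016, §2.1] -/
theorem f_ne (i : Fin 24) : f (J i) ≠ f i := by
  intro h
  have h' := congrArg φ h
  rw [φ_f, φ_f] at h'
  exact fimg_ne i h'

/-- **`Γ_JW` is not diffuse**: the 24 words `f` form a ravel (a finite set without extremal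
point) inside the ball of radius 3. The separating quotient has order 6 although `Γ_JW` is not residually finite; most small ravels of `Γ_JW` contain pairs that no finite quotient separates. [cite: Bowditch2000, §1] [cite: KionkeRaimbault2016, §2.1] -/
theorem not_diffuse : ¬ Diffuse GammaJWGroup :=
  not_diffuse_of_witnesses f J K f_ne f_rel

/-- Hence `Γ_JW` admits no left-invariant linear order (left-orderable groups are diffuse).
[cite: Bowditch2000, §1] -/
theorem not_leftOrdered [LinearOrder GammaJWGroup] : ¬ MulLeftStrictMono GammaJWGroup :=
  fun _ => not_diffuse diffuse_of_mulLeftStrictMono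

end GammaJW

end Literature.GroupTheory.BMWGroups.Caprace2017
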